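import Summits.QuantumFields.YangMills.Theorems.BalabanUVNodesPortS1JacKStepProof

/-!
# Crux `PortRecordRepresentationS1` (stmt-QuantumFields-27930), line `pta-residueW` (skeleton v3) — REGISTERED STUB `stub_LZjacKStep` LANDED: `∀ F, JacKStep F` (the `k`-step reading of the
# record space (1.11)–(1.16): a `det = 1` gauge transform of every record pair is tower-loop-small), by `…JacKStepProof.jacKStep_holds`

Cell `ym-nodeO-ideate`, porter seat `ymgap-nodeO-port-PTA-1` (gen 6, lead of the line); `--supports stmt-QuantumFields-27930` (stub credit: proves the registered stub BY NAME AND SIGNATURE).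
After this file the skeleton `Cruxes/PortRecordRepresentationS1/Lines/pta_residueW.lean` has THREE open stubs: `stub_LZjacDom : ∀ F, JacRowsABDom F` (P0-free · M · PTZ-1's rows localized),
`stub_LZdet` (BLOCKED-ON P0 (α)+(β)), `stub_FE` (XXL).

HONEST FRAMING.  One registered stub of four is proved — by COMPOSITION of landed theorems (★19200-p2's `k`-uniform reads bound, pv26's box axial gauge, dag-n07-e's box plumbing, PTZ-1's
covariance ∕ `det` lemmas, dag-n12-c's locality); NOTHING of Bałaban's renormalization-group estimates asserted or re-proved; the crux 27930 ⁸-Ax-LR4 is OPEN · no claim; K0⁷∕K-Ax OPEN; NODE O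
0∕1; COUNT 8∕28 · K 1∕4 UNMOVED; finite `𝕋⁴_{L^K}` at fixed ε — NOT continuum ∕ OS ∕ Clay; **the Yang–Mills mass gap is NOT proved by any of this.**  No `sorry`; standard axioms.
-/

namespace Summit.QuantumFields.YangMills.Theorems.BalabanUVNodesPortS1

/-- ★★★ **REGISTERED STUB `stub_LZjacKStep` OF THE LINE `pta-residueW`**: the `k`-step reading of the record space holds for every torus family. [cite: Balaban1987RG1, p.263 L8–10, (1.11)–(1.16) p.262; Balaban1985Averaging, Prop. 2 (54) p.26] -/
theorem stub_LZjacKStep : ∀ F, Summit.QuantumFields.YangMills.Theorems.BalabanUVNodesPortS1.JacKStep F :=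
  fun F => jacKStep_holds F

end Summit.QuantumFields.YangMills.Theorems.BalabanUVNodesPortS1
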